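import Mathlib
import Summits.ValiantsHypothesis.ValiantsHypothesis.Theorems.FifoMatchingNNNotVPDivisionSplitDefs
import HarnessLib

/-!
# Route FifoMatching — crux `NNNotVP` (stmt-ValiantsHypothesis-11615), line `division_split`:
# support-function calculus and the free-arc-free core of stub A `stub_supportFnHard`

Registered line `Cruxes/NNNotVP/Lines/division_split.lean`; objects `σ` / `NN` / `SuppFn` /
`freeVars` = the line's vocabulary, verbatim, in `Theorems/FifoMatchingNNNotVPDivisionSplitDefs.lean`.

Stub **A** (`stub_supportFnHard`) asks, for all `k, c` and all large `n`, that every nonnegative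
polynomial `g` with the SUPPORT FUNCTION of `NN_n|_{T := 1}` (`|T| ≤ (log₂ n + k)^k` freed arcs) has
`L₊(g) > 2^((log₂ n + c)^c)`.  This file supplies the support-function calculus the stub is stated
in, and the easy half of its reduction to the free-arc-free CORE (`T = ∅`):

* `suppFn_iff_eval_ne_zero` — over `ℝ≥0`, `SuppFn g A` says exactly that `g` does not vanish at the
  0/1 point `1_A` (no cancellation); hence the support function is what a monotone computation of
  `g` decides over the Boolean semiring;
* `suppFn_aeval_iff` — TRANSFER: along any substitution `φ` whose values at a 0/1 point are again
  0/1 (`x_v ↦ 1`, `↦ 0`, `↦` a variable), `SuppFn (aeval φ g) A ↔ SuppFn g B` with `B` the pulled-back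
  set; so polynomials with equal support functions keep equal support functions (`suppFn_aeval_congr`);
* `suppFn_freeVars_iff` — freeing `T` pulls `A` back to `T ∪ A`; `freeVars_empty`;
* `core_of_supportFnHard` — stub A (verbatim, as a hypothesis) implies its `T = ∅` core.

Honest framing: bookkeeping for one registered stub; the core (a super-quasi-polynomial monotone
BOOLEAN circuit lower bound for nest-free perfect-matching / shuffle-square recognition on ordered
graphs) stays OPEN, as do stubs Z, A, B2, the crux `NNNotVP`, and `VP ≠ VNP` (NOT proved).
No definitions, no named facts.
-/

noncomputable section

-- Sub = Summit single-conjunct layout: the duplicated namespace component is mandated by the tree.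
set_option linter.dupNamespace false

namespace Summit.ValiantsHypothesis.ValiantsHypothesis.Theorems.FifoMatching.NNNotVP.DivisionSplit

open MvPolynomial Literature.Computability.AlgebraicComplexity
open scoped NNReal BigOperators Classical

variable {τ : Type*}

/-! ### The support function as a Boolean evaluation -/

/-- The 0/1 point `1_A` of a variable set `A`. [folklore] -/
theorem prod_indicator_pow_eq (A : Finset τ) (d : τ →₀ ℕ) :
    (∏ v ∈ d.support, (if v ∈ A then (1 : ℝ≥0) else 0) ^ d v) =
      if d.support ⊆ A then 1 else 0 := by
  split_ifs with h
  · refine Finset.prod_eq_one fun v hv => ?_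
    rw [if_pos (h hv), one_pow]
  · obtain ⟨v, hv, hvA⟩ := Finset.not_subset.1 h
    refine Finset.prod_eq_zero hv ?_
    rw [if_neg hvA, zero_pow]
    exact Finsupp.mem_support_iff.1 hv

/-- **The support function is a Boolean evaluation.**  Over `ℝ≥0` (no cancellation),
`SuppFn g A` holds iff `g` does not vanish at the 0/1 point `1_A`. [folklore] -/
theorem suppFn_iff_eval_ne_zero (g : MvPolynomial τ ℝ≥0) (A : Finset τ) :
    SuppFn g A ↔ eval (fun v => if v ∈ A then (1 : ℝ≥0) else 0) g ≠ 0 := by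
  rw [MvPolynomial.eval_eq]
  simp_rw [prod_indicator_pow_eq]
  rw [Ne, Finset.sum_eq_zero_iff, not_forall]
  constructor
  · rintro ⟨m, hm, hmA⟩
    refine ⟨m, fun h => ?_⟩
    have h' := h hm
    rw [if_pos hmA, mul_one] at h'
    exact (mem_support_iff.1 hm) h'
  · rintro ⟨m, hm⟩
    rw [Classical.not_imp] at hm
    obtain ⟨hm, hne⟩ := hm
    refine ⟨m, hm, ?_⟩
    by_contra hmA
    rw [if_neg hmA, mul_zero] at hne
    exact hne rfl

/-- The support function is monotone in the variable set. [folklore] -/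
theorem SuppFn.mono {g : MvPolynomial τ ℝ≥0} {A B : Finset τ} (hAB : A ⊆ B) (h : SuppFn g A) :
    SuppFn g B := by
  obtain ⟨m, hm, hmA⟩ := h
  exact ⟨m, hm, hmA.trans hAB⟩

/-- Polynomials with equal supports have equal support functions. [folklore] -/
theorem suppFn_iff_of_support_eq {g f : MvPolynomial τ ℝ≥0} (h : g.support = f.support)
    (A : Finset τ) : SuppFn g A ↔ SuppFn f A := by
  unfold SuppFn
  rw [h]

/-! ### Transfer along 0/1-preserving substitutions -/

/-- **Transfer of the support function along a substitution.**  If every `φ v` takes, at the 0/1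
point `1_A`, the value `1` for `v ∈ B` and `0` otherwise (e.g. `φ v ∈ {0, 1, x_w}`), then
`SuppFn (aeval φ g) A ↔ SuppFn g B`. [folklore] -/
theorem suppFn_aeval_iff {τ' : Type*} (φ : τ → MvPolynomial τ' ℝ≥0) (g : MvPolynomial τ ℝ≥0)
    (A : Finset τ') (B : Finset τ)
    (hφ : ∀ v, eval (fun w => if w ∈ A then (1 : ℝ≥0) else 0) (φ v) = if v ∈ B then 1 else 0) :
    SuppFn (aeval φ g) A ↔ SuppFn g B := by
  rw [suppFn_iff_eval_ne_zero, suppFn_iff_eval_ne_zero]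
  have key : eval (fun w => if w ∈ A then (1 : ℝ≥0) else 0) (aeval φ g) =
      eval (fun v => if v ∈ B then (1 : ℝ≥0) else 0) g := by
    rw [MvPolynomial.aeval_eq_bind₁]
    change eval₂Hom (RingHom.id _) _ (bind₁ φ g) = eval₂Hom (RingHom.id _) _ g
    rw [eval₂Hom_bind₁]
    congr 1
    congr 1
    funext v
    exact hφ v
  rw [key]

/-- **Support-function genericity of substitutions.**  Two polynomials with the same support
function keep the same support function under any 0/1-preserving substitution. [folklore] -/
theorem suppFn_aeval_congr {τ' : Type*} (φ : τ → MvPolynomial τ' ℝ≥0) (B : Finset τ' → Finset τ)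
    (hφ : ∀ A v, eval (fun w => if w ∈ A then (1 : ℝ≥0) else 0) (φ v) = if v ∈ B A then 1 else 0)
    {g f : MvPolynomial τ ℝ≥0} (h : ∀ A : Finset τ, SuppFn g A ↔ SuppFn f A) (A : Finset τ') :
    SuppFn (aeval φ g) A ↔ SuppFn (aeval φ f) A := by
  rw [suppFn_aeval_iff φ g A (B A) (hφ A), suppFn_aeval_iff φ f A (B A) (hφ A)]
  exact h (B A)

/-- **Freeing variables pulls the variable set back to `T ∪ A`.** [folklore] -/
theorem suppFn_freeVars_iff (T : Finset τ) (g : MvPolynomial τ ℝ≥0) (A : Finset τ) :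
    SuppFn (freeVars T g) A ↔ SuppFn g (T ∪ A) := by
  unfold freeVars
  refine suppFn_aeval_iff _ g A (T ∪ A) fun v => ?_
  by_cases hv : v ∈ T
  · rw [if_pos hv, map_one, if_pos (Finset.mem_union_left A hv)]
  · rw [if_neg hv, eval_X]
    by_cases hvA : v ∈ A
    · rw [if_pos hvA, if_pos (Finset.mem_union_right T hvA)]
    · rw [if_neg hvA, if_neg (by rw [Finset.mem_union, not_or]; exact ⟨hv, hvA⟩)]

/-- Freeing no variable is the identity. [folklore] -/
theorem freeVars_empty (g : MvPolynomial τ ℝ≥0) : freeVars ∅ g = g := by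
  unfold freeVars
  have h : (fun v : τ => if v ∈ (∅ : Finset τ) then (1 : MvPolynomial τ ℝ≥0) else X v) = X := by
    funext v
    rw [if_neg (Finset.notMem_empty v)]
  rw [h, aeval_X_left, AlgHom.id_apply]

/-- Freed variables already in the set change nothing. [folklore] -/
theorem suppFn_freeVars_iff_of_subset {T A : Finset τ} (hTA : T ⊆ A) (g : MvPolynomial τ ℝ≥0) :
    SuppFn (freeVars T g) A ↔ SuppFn g A := by
  rw [suppFn_freeVars_iff, Finset.union_eq_right.2 hTA]

/-! ### Stub A implies its free-arc-free core -/

/-- **Stub A ⇒ its `T = ∅` core.**  The registered stub `stub_supportFnHard` (verbatim, as the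
hypothesis) yields, at `T = ∅`: for all `c` and all large `n`, every nonnegative polynomial with the
support function of `NN_n` itself has `L₊ > 2^((log₂ n + c)^c)` — the arithmetic form of a
super-quasi-polynomial monotone Boolean circuit lower bound for nest-free perfect-matching
(shuffle-square) recognition on ordered graphs.  (OPEN; the converse reduction is the companion
file's `supportFnHard_of_core`.) [folklore] -/
theorem core_of_supportFnHard
    (hA : ∀ k c : ℕ, ∃ n₀ : ℕ, ∀ n ≥ n₀, ∀ T : Finset (σ n), T.card ≤ (Nat.log 2 n + k) ^ k →
      ∀ g : MvPolynomial (σ n) ℝ≥0, (∀ A : Finset (σ n), SuppFn g A ↔ SuppFn (freeVars T (NN n)) A) →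
        2 ^ ((Nat.log 2 n + c) ^ c) < complexity g) :
    ∀ c : ℕ, ∃ n₀ : ℕ, ∀ n ≥ n₀, ∀ g : MvPolynomial (σ n) ℝ≥0,
      (∀ A : Finset (σ n), SuppFn g A ↔ SuppFn (NN n) A) →
        2 ^ ((Nat.log 2 n + c) ^ c) < complexity g := by
  intro c
  obtain ⟨n₀, hn₀⟩ := hA 0 c
  refine ⟨n₀, fun n hn g hg => hn₀ n hn ∅ (by rw [Finset.card_empty]; exact Nat.zero_le _) g ?_⟩
  intro A
  rw [freeVars_empty]
  exact hg A

end Summit.ValiantsHypothesis.ValiantsHypothesis.Theorems.FifoMatching.NNNotVP.DivisionSplit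

end
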